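import Summits.CriticalPhenomena.Ising3DConformalLimit.Theorems.Interlacing.Negative.LoadBearingAnalysis

/-!
# `Interlacing` (item stmt-CriticalPhenomena-15702): the balanced family plus every landed two-point fact
# does not give the other gaps (standing crux disprover, gen 2 — answer to the lead's `disprover-wanted`)

The continuation lead of line `Sketch` (cycle c1-1, `Cruxes/Interlacing/Lines/Sketch.md`) observed that the route's
assembly consumes the crux `Interlacing` (SPC `S₄·P₂ ≤ P₁·P₃` at ALL gap triples `a, b, c ≥ 1`) only at the
BALANCED axis quadruples `(0, 2N, 3N, 6N)·e₁` (cross-ratio `z = ½`; landed transfer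
`transfer_ising3D_of_balanced`, p140149), recommended restating the crux to that family, and asked the disprover
for a `Negative` lemma separating the balanced family from the remaining instances ("a `_false_without_` showing the
bands are NOT implied by the balanced family plus landed two-point facts").

`not_allGaps_of_balanced_and_twoPointFacts` is that lemma, in the abstract currency of
`engine_inputs_insufficient` (same directory) but for a whole consistent FAMILY of pairing weights: there is ONE
axial two-point function `G : ℕ → ℝ` with `G 0 = 1`, `0 < G ≤ 1`, non-increasing (Messager–Miracle-Solé, the
shape of the landed `stub_monotone`: `G(a+b)G(b+c) ≤ G(a)G(c)`), log-convex in the GLOBAL form of the landed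
`stub_logConvex` (`G(a+b)G(b+c) ≤ G(a+b+c)G(b)` for all `a b c : ℕ`), inside the rigorous critical envelope
`1/(3n²) ≤ G(n) ≤ 1/n` (Simon–Lieb floor / infrared bound shapes), and ONE reversal-symmetric four-point assignment
`S(a,b,c)` obeying Griffiths II (`S ≥` each pairing), Lebowitz (`S ≤ P₁+P₂+P₃`) and the switching range
`S ≥ P₁+P₃−P₂` (i.e. `S = P₁+P₂+P₃ − 2P₂·I` with a merging probability `I ∈ [0,1]` — here `I ≡ 9/10` at EVERY
shape), such that SPC holds at every balanced shape `(2N, N, 3N)`, `N ≥ 1`, and FAILS at the gaps `(1,1,1)`.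

Model: `G(n) = 3^{-n}` for `n ≤ 3` continued by `G(n) = 1/(3n²)` (`C¹`-matching at `n = 3`, so `log G` stays
convex), `S = P₁+P₂+P₃ − (9/5)·P₂`. Mechanism (the information for provers): in merging form SPC reads
`2P₂²(1 − I) ≤ (P₁ − P₂)(P₃ − P₂)`, so at ANY shape with merging probability `I < 1` it needs STRICT axial
log-convexity `t = P₃/P₂ > 1` (and strict monotonicity `u = P₁/P₂ > 1`) QUANTITATIVELY; the geometric head makes
`t(1,1,1) = 1` exactly, which kills `(1,1,1)` for every `I < 1`, while at the balanced shapes `u, t ≥ 4` and SPC holds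
with room for every `I ≥ 0`. Reflection positivity gives only `t ≥ 1`; no landed or printed fact bounds
`t(a,b,c) − 1` below at `β_c(3)`. So the non-balanced instances of the crux carry content (quantitative strict
log-convexity of the critical two-point function at the scale of the gaps) that the balanced family does not
deliver even with a 90 % merging floor everywhere — and, read the other way, the balanced family itself needs
`(u_N − 1)(t_N − 1) ≥ 2(1 − I_N) > 0`, i.e. strict log-convexity at scale `N`, uniformly.
THEOREM-ONLY, no new definitions, no named facts.
-/

namespace Summit.CriticalPhenomena.Ising3DConformalLimit.InterlacingNegative

/-! ### Local-to-global axial log-convexity and monotonicity (elementary) -/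

/-- Ratio monotonicity from local log-convexity of a positive sequence:
`G(m+1)·G(m+k) ≤ G(m)·G(m+k+1)`. [folklore] -/
theorem logConvex_ratio_mono {G : ℕ → ℝ} (hpos : ∀ n, 0 < G n)
    (hloc : ∀ n, G (n + 1) * G (n + 1) ≤ G n * G (n + 2)) :
    ∀ m k : ℕ, G (m + 1) * G (m + k) ≤ G m * G (m + k + 1) := by
  intro m k
  induction k with
  | zero => exact le_of_eq (by ring)
  | succ k ih =>
    have hl := hloc (m + k)
    have hp : 0 < G (m + k) * G (m + k + 1) := mul_pos (hpos _) (hpos _)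
    have e1 : m + (k + 1) = m + k + 1 := by omega
    have e2 : m + k + 1 + 1 = m + k + 2 := by omega
    rw [e1, e2]
    have hprod := mul_le_mul ih hl (mul_nonneg (hpos _).le (hpos _).le) (mul_nonneg (hpos _).le (hpos _).le)
    refine le_of_mul_le_mul_right ?_ hp
    calc G (m + 1) * G (m + k + 1) * (G (m + k) * G (m + k + 1))
        = G (m + 1) * G (m + k) * (G (m + k + 1) * G (m + k + 1)) := by ring
      _ ≤ G m * G (m + k + 1) * (G (m + k) * G (m + k + 2)) := hprod
      _ = G m * G (m + k + 2) * (G (m + k) * G (m + k + 1)) := by ring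

/-- **Local ⇒ global log-convexity**: a positive sequence with `G(n+1)² ≤ G(n)G(n+2)` satisfies the global
(majorisation) form used by the crux's line, `G(a+b)·G(b+c) ≤ G(a+b+c)·G(b)` for all `a b c`. [folklore] -/
theorem logConvex_global_of_local {G : ℕ → ℝ} (hpos : ∀ n, 0 < G n)
    (hloc : ∀ n, G (n + 1) * G (n + 1) ≤ G n * G (n + 2)) :
    ∀ a b c : ℕ, G (a + b) * G (b + c) ≤ G (a + b + c) * G b := by
  intro a
  induction a with
  | zero =>
    intro b c
    simp only [zero_add]
    exact le_of_eq (mul_comm _ _)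
  | succ a ih =>
    intro b c
    have h1 := ih b c
    have h2 := logConvex_ratio_mono hpos hloc (a + b) c
    have hp : 0 < G (a + b) * G (a + b + c) := mul_pos (hpos _) (hpos _)
    have e1 : a + 1 + b = a + b + 1 := by omega
    have e2 : a + b + 1 + c = a + b + c + 1 := by omega
    rw [e1, e2]
    refine le_of_mul_le_mul_right ?_ hp
    have hprod := mul_le_mul h1 h2 (mul_nonneg (hpos _).le (hpos _).le) (mul_nonneg (hpos _).le (hpos _).le)
    calc G (a + b + 1) * G (b + c) * (G (a + b) * G (a + b + c))
        = G (a + b) * G (b + c) * (G (a + b + 1) * G (a + b + c)) := by ring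
      _ ≤ G (a + b + c) * G b * (G (a + b) * G (a + b + c + 1)) := hprod
      _ = G (a + b + c + 1) * G b * (G (a + b) * G (a + b + c)) := by ring

/-- Messager–Miracle-Solé shape from plain monotonicity: a positive non-increasing sequence satisfies
`G(a+b)·G(b+c) ≤ G(a)·G(c)`. [folklore] -/
theorem mms_of_succ_le {G : ℕ → ℝ} (hpos : ∀ n, 0 < G n) (hsucc : ∀ n, G (n + 1) ≤ G n) :
    ∀ a b c : ℕ, G (a + b) * G (b + c) ≤ G a * G c := by
  have hA : Antitone G := antitone_nat_of_succ_le hsucc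
  intro a b c
  exact mul_le_mul (hA (Nat.le_add_right a b)) (hA (Nat.le_add_left c b)) (hpos _).le (hpos _).le

/-! ### The model two-point function `G(n) = 3^{-n}` (`n ≤ 3`), `1/(3n²)` (`n ≥ 3`) -/

/-- `G 0 = 1`. [folklore] -/
theorem model_zero {G : ℕ → ℝ}
    (hG : ∀ n : ℕ, G n = if n < 3 then (1 / 3 : ℝ) ^ n else 1 / (3 * (n : ℝ) ^ 2)) : G 0 = 1 := by
  rw [hG]; norm_num

/-- `G 1 = 1/3`. [folklore] -/
theorem model_one {G : ℕ → ℝ}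
    (hG : ∀ n : ℕ, G n = if n < 3 then (1 / 3 : ℝ) ^ n else 1 / (3 * (n : ℝ) ^ 2)) : G 1 = 1 / 3 := by
  rw [hG]; norm_num

/-- `G 2 = 1/9`. [folklore] -/
theorem model_two {G : ℕ → ℝ}
    (hG : ∀ n : ℕ, G n = if n < 3 then (1 / 3 : ℝ) ^ n else 1 / (3 * (n : ℝ) ^ 2)) : G 2 = 1 / 9 := by
  rw [hG]; norm_num

/-- The power-law tail: `G n = 1/(3n²)` for `n ≥ 3`. [folklore] -/
theorem model_tail {G : ℕ → ℝ}
    (hG : ∀ n : ℕ, G n = if n < 3 then (1 / 3 : ℝ) ^ n else 1 / (3 * (n : ℝ) ^ 2)) {n : ℕ} (hn : 3 ≤ n) :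
    G n = 1 / (3 * (n : ℝ) ^ 2) := by
  rw [hG, if_neg (by omega)]

/-- `G 3 = 1/27` (the two branches agree at `n = 3`). [folklore] -/
theorem model_three {G : ℕ → ℝ}
    (hG : ∀ n : ℕ, G n = if n < 3 then (1 / 3 : ℝ) ^ n else 1 / (3 * (n : ℝ) ^ 2)) : G 3 = 1 / 27 := by
  rw [model_tail hG le_rfl]; norm_num

/-- `G 4 = 1/48`. [folklore] -/
theorem model_four {G : ℕ → ℝ}
    (hG : ∀ n : ℕ, G n = if n < 3 then (1 / 3 : ℝ) ^ n else 1 / (3 * (n : ℝ) ^ 2)) : G 4 = 1 / 48 := by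
  rw [model_tail hG (by norm_num)]; norm_num

/-- `G 6 = 1/108`. [folklore] -/
theorem model_six {G : ℕ → ℝ}
    (hG : ∀ n : ℕ, G n = if n < 3 then (1 / 3 : ℝ) ^ n else 1 / (3 * (n : ℝ) ^ 2)) : G 6 = 1 / 108 := by
  rw [model_tail hG (by norm_num)]; norm_num

/-- `G 8 = 1/192`. [folklore] -/
theorem model_eight {G : ℕ → ℝ}
    (hG : ∀ n : ℕ, G n = if n < 3 then (1 / 3 : ℝ) ^ n else 1 / (3 * (n : ℝ) ^ 2)) : G 8 = 1 / 192 := by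
  rw [model_tail hG (by norm_num)]; norm_num

/-- `G 12 = 1/432`. [folklore] -/
theorem model_twelve {G : ℕ → ℝ}
    (hG : ∀ n : ℕ, G n = if n < 3 then (1 / 3 : ℝ) ^ n else 1 / (3 * (n : ℝ) ^ 2)) : G 12 = 1 / 432 := by
  rw [model_tail hG (by norm_num)]; norm_num

/-- Positivity of the model. [folklore] -/
theorem model_pos {G : ℕ → ℝ}
    (hG : ∀ n : ℕ, G n = if n < 3 then (1 / 3 : ℝ) ^ n else 1 / (3 * (n : ℝ) ^ 2)) : ∀ n, 0 < G n := by
  intro n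
  rcases lt_or_ge n 3 with hn | hn
  · rw [hG, if_pos hn]; positivity
  · rw [model_tail hG hn]
    have hn0 : (0 : ℝ) < n := by exact_mod_cast (show 0 < n by omega)
    positivity

/-- The model is non-increasing. [folklore] -/
theorem model_succ_le {G : ℕ → ℝ}
    (hG : ∀ n : ℕ, G n = if n < 3 then (1 / 3 : ℝ) ^ n else 1 / (3 * (n : ℝ) ^ 2)) :
    ∀ n, G (n + 1) ≤ G n := by
  intro n
  rcases lt_or_ge n 3 with hn | hn
  · interval_cases n
    · rw [model_one hG, model_zero hG]; norm_num
    · rw [model_two hG, model_one hG]; norm_num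
    · rw [model_three hG, model_two hG]; norm_num
  · rw [model_tail hG (by omega : 3 ≤ n + 1), model_tail hG hn]
    have hn0 : (0 : ℝ) < n := by exact_mod_cast (show 0 < n by omega)
    push_cast
    have hA : (0 : ℝ) < 3 * ((n : ℝ) + 1) ^ 2 := by positivity
    have hB : (0 : ℝ) < 3 * (n : ℝ) ^ 2 := mul_pos (by norm_num) (pow_pos hn0 2)
    rw [one_div_le_one_div hA hB]
    nlinarith [sq_nonneg (n : ℝ), hn0.le]

/-- `G ≤ 1`. [folklore] -/
theorem model_le_one {G : ℕ → ℝ}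
    (hG : ∀ n : ℕ, G n = if n < 3 then (1 / 3 : ℝ) ^ n else 1 / (3 * (n : ℝ) ^ 2)) : ∀ n, G n ≤ 1 := by
  intro n
  have hA : Antitone G := antitone_nat_of_succ_le (model_succ_le hG)
  simpa [model_zero hG] using hA (Nat.zero_le n)

/-- LOCAL log-convexity of the model (`C¹` matching at the junction `n = 3`; equality on the geometric head).
[folklore] -/
theorem model_local {G : ℕ → ℝ}
    (hG : ∀ n : ℕ, G n = if n < 3 then (1 / 3 : ℝ) ^ n else 1 / (3 * (n : ℝ) ^ 2)) :
    ∀ n, G (n + 1) * G (n + 1) ≤ G n * G (n + 2) := by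
  intro n
  rcases lt_or_ge n 3 with hn | hn
  · interval_cases n
    · rw [model_one hG, model_zero hG, model_two hG]; norm_num
    · rw [model_two hG, model_one hG, model_three hG]; norm_num
    · rw [model_three hG, model_two hG, model_four hG]; norm_num
  · rw [model_tail hG (by omega : 3 ≤ n + 1), model_tail hG hn, model_tail hG (by omega : 3 ≤ n + 2)]
    have hn0 : (0 : ℝ) < n := by exact_mod_cast (show 0 < n by omega)
    push_cast
    rw [div_mul_div_comm, div_mul_div_comm, one_mul]
    have hA : (0 : ℝ) < 3 * ((n : ℝ) + 1) ^ 2 * (3 * ((n : ℝ) + 1) ^ 2) := by positivity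
    have hB : (0 : ℝ) < 3 * (n : ℝ) ^ 2 * (3 * ((n : ℝ) + 2) ^ 2) :=
      mul_pos (mul_pos (by norm_num) (pow_pos hn0 2)) (by positivity)
    rw [one_div_le_one_div hA hB]
    nlinarith [sq_nonneg (n : ℝ), hn0.le]

/-- The model sits in the critical envelope `1/(3n²) ≤ G(n) ≤ 1/n` (`n ≥ 1`). [folklore] -/
theorem model_bounds {G : ℕ → ℝ}
    (hG : ∀ n : ℕ, G n = if n < 3 then (1 / 3 : ℝ) ^ n else 1 / (3 * (n : ℝ) ^ 2)) :
    ∀ n : ℕ, 1 ≤ n → 1 / (3 * (n : ℝ) ^ 2) ≤ G n ∧ G n ≤ 1 / n := by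
  intro n hn
  rcases lt_or_ge n 3 with h3 | h3
  · interval_cases n
    · rw [model_one hG]; norm_num
    · rw [model_two hG]; norm_num
  · rw [model_tail hG h3]
    have hn3 : (3 : ℝ) ≤ n := by exact_mod_cast h3
    refine ⟨le_rfl, ?_⟩
    have hB : (0 : ℝ) < (n : ℝ) := by linarith
    have hA : (0 : ℝ) < 3 * (n : ℝ) ^ 2 := mul_pos (by norm_num) (pow_pos hB 2)
    rw [one_div_le_one_div hA hB]
    nlinarith [hn3]

/-- **Balanced SPC holds in the model for every merging level `I₀ ≥ 0`**: at the shapes `(2N, N, 3N)`, `N ≥ 1`,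
`S·P₂ ≤ P₁·P₃` with `S = P₁+P₂+P₃ − 2P₂·I₀` (here `u = P₁/P₂ ≥ 4`, `t = P₃/P₂ ≥ 4`). [folklore] -/
theorem model_balanced {G : ℕ → ℝ}
    (hG : ∀ n : ℕ, G n = if n < 3 then (1 / 3 : ℝ) ^ n else 1 / (3 * (n : ℝ) ^ 2)) (I₀ : ℝ) (hI : 0 ≤ I₀) :
    ∀ N : ℕ, 1 ≤ N →
      (G (2 * N) * G (3 * N) + G (2 * N + N + 3 * N) * G N + G (2 * N + N) * G (N + 3 * N) * (1 - 2 * I₀)) *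
          (G (2 * N + N) * G (N + 3 * N)) ≤
        G (2 * N) * G (3 * N) * (G (2 * N + N + 3 * N) * G N) := by
  intro N hN
  have e3 : 2 * N + N = 3 * N := by ring
  have e4 : N + 3 * N = 4 * N := by ring
  have e6 : 3 * N + 3 * N = 6 * N := by ring
  rw [e3, e4, e6]
  rw [← sub_nonneg]
  rcases lt_or_ge N 3 with h3 | h3
  · interval_cases N
    · rw [show 2 * 1 = 2 from rfl, show 3 * 1 = 3 from rfl, show 4 * 1 = 4 from rfl, show 6 * 1 = 6 from rfl,
        model_one hG, model_two hG, model_three hG, model_four hG, model_six hG]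
      have key : (1 : ℝ) / 9 * (1 / 27) * (1 / 108 * (1 / 3)) -
          (1 / 9 * (1 / 27) + 1 / 108 * (1 / 3) + 1 / 27 * (1 / 48) * (1 - 2 * I₀)) * (1 / 27 * (1 / 48)) =
            (11 + 2 * I₀) / 1679616 := by ring
      rw [key]
      exact div_nonneg (by linarith) (by norm_num)
    · rw [show 2 * 2 = 4 from rfl, show 3 * 2 = 6 from rfl, show 4 * 2 = 8 from rfl, show 6 * 2 = 12 from rfl,
        model_two hG, model_four hG, model_six hG, model_eight hG, model_twelve hG]
      have key : (1 : ℝ) / 48 * (1 / 108) * (1 / 432 * (1 / 9)) -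
          (1 / 48 * (1 / 108) + 1 / 432 * (1 / 9) + 1 / 108 * (1 / 192) * (1 - 2 * I₀)) * (1 / 108 * (1 / 192)) =
            (11 + 2 * I₀) / 429981696 := by ring
      rw [key]
      exact div_nonneg (by linarith) (by norm_num)
  · have hN0 : (0 : ℝ) < N := by exact_mod_cast (show 0 < N by omega)
    have hN1 : (N : ℝ) ≠ 0 := ne_of_gt hN0
    have g1 : G N = 1 / (3 * (N : ℝ) ^ 2) := model_tail hG h3
    have g2 : G (2 * N) = 1 / (3 * (2 * (N : ℝ)) ^ 2) := by
      have h := model_tail hG (show 3 ≤ 2 * N by omega); push_cast at h; exact h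
    have g3 : G (3 * N) = 1 / (3 * (3 * (N : ℝ)) ^ 2) := by
      have h := model_tail hG (show 3 ≤ 3 * N by omega); push_cast at h; exact h
    have g4 : G (4 * N) = 1 / (3 * (4 * (N : ℝ)) ^ 2) := by
      have h := model_tail hG (show 3 ≤ 4 * N by omega); push_cast at h; exact h
    have g6 : G (6 * N) = 1 / (3 * (6 * (N : ℝ)) ^ 2) := by
      have h := model_tail hG (show 3 ≤ 6 * N by omega); push_cast at h; exact h
    rw [g1, g2, g3, g4, g6]
    have key : (1 : ℝ) / (3 * (2 * (N : ℝ)) ^ 2) * (1 / (3 * (3 * (N : ℝ)) ^ 2)) *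
          (1 / (3 * (6 * (N : ℝ)) ^ 2) * (1 / (3 * (N : ℝ) ^ 2))) -
        (1 / (3 * (2 * (N : ℝ)) ^ 2) * (1 / (3 * (3 * (N : ℝ)) ^ 2)) +
              1 / (3 * (6 * (N : ℝ)) ^ 2) * (1 / (3 * (N : ℝ) ^ 2)) +
            1 / (3 * (3 * (N : ℝ)) ^ 2) * (1 / (3 * (4 * (N : ℝ)) ^ 2)) * (1 - 2 * I₀)) *
          (1 / (3 * (3 * (N : ℝ)) ^ 2) * (1 / (3 * (4 * (N : ℝ)) ^ 2))) =
        (7 + 2 * I₀) / 1679616 * ((N : ℝ) ^ 2)⁻¹ ^ 4 := by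
      field_simp
      ring
    rw [key]
    have h7 : (0 : ℝ) ≤ 7 + 2 * I₀ := by linarith
    exact mul_nonneg (div_nonneg h7 (by norm_num)) (by positivity)

/-- **The model violates SPC at the gaps `(1,1,1)` for every merging level `I₀ < 1`** (`t(1,1,1) = 1` on the
geometric head). [folklore] -/
theorem model_not_spc_one_one_one {G : ℕ → ℝ}
    (hG : ∀ n : ℕ, G n = if n < 3 then (1 / 3 : ℝ) ^ n else 1 / (3 * (n : ℝ) ^ 2)) (I₀ : ℝ) (hI : I₀ < 1) :
    ¬ (G 1 * G 1 + G (1 + 1 + 1) * G 1 + G (1 + 1) * G (1 + 1) * (1 - 2 * I₀)) * (G (1 + 1) * G (1 + 1)) ≤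
        G 1 * G 1 * (G (1 + 1 + 1) * G 1) := by
  rw [show 1 + 1 + 1 = 3 from rfl, show 1 + 1 = 2 from rfl, model_one hG, model_two hG, model_three hG]
  intro h
  have key : ((1 : ℝ) / 3 * (1 / 3) + 1 / 27 * (1 / 3) + 1 / 9 * (1 / 9) * (1 - 2 * I₀)) * (1 / 9 * (1 / 9)) -
      1 / 3 * (1 / 3) * (1 / 27 * (1 / 3)) = (2 - 2 * I₀) / 6561 := by ring
  have hpos : (0 : ℝ) < (2 - 2 * I₀) / 6561 := div_pos (by linarith) (by norm_num)
  linarith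

/-! ### The separation -/

/-- **The balanced family, together with every landed two-point fact, Griffiths II, Lebowitz and the switching
range, does NOT imply the other instances of the crux.** It is false that for all axial two-point data `G` and
four-point data `S` with: `G 0 = 1`, `0 < G ≤ 1`, `G` non-increasing, the MMS shape `G(a+b)G(b+c) ≤ G(a)G(c)`
(`stub_monotone`), global log-convexity `G(a+b)G(b+c) ≤ G(a+b+c)G(b)` (`stub_logConvex`), the critical envelope
`1/(3n²) ≤ G(n) ≤ 1/n`, reversal symmetry of `S`, Griffiths II, Lebowitz and `S ≥ P₁+P₃−P₂` (merging probability
`≤ 1`), SPC at all balanced shapes `(2N,N,3N)` (`N ≥ 1`) implies SPC at all gaps `a,b,c ≥ 1`. Witness: the model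
above with `S = P₁+P₂+P₃ − (9/5)P₂` (merging probability `9/10` at every shape), failing at `(1,1,1)`. [folklore] -/
theorem not_allGaps_of_balanced_and_twoPointFacts :
    ¬ ∀ (G : ℕ → ℝ) (S : ℕ → ℕ → ℕ → ℝ),
        G 0 = 1 → (∀ n, 0 < G n) → (∀ n, G n ≤ 1) → (∀ n, G (n + 1) ≤ G n) →
        (∀ a b c : ℕ, G (a + b) * G (b + c) ≤ G a * G c) →
        (∀ a b c : ℕ, G (a + b) * G (b + c) ≤ G (a + b + c) * G b) →
        (∀ n : ℕ, 1 ≤ n → 1 / (3 * (n : ℝ) ^ 2) ≤ G n ∧ G n ≤ 1 / n) →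
        (∀ a b c : ℕ, S a b c = S c b a) →
        (∀ a b c : ℕ, G a * G c ≤ S a b c ∧ G (a + b) * G (b + c) ≤ S a b c ∧ G (a + b + c) * G b ≤ S a b c) →
        (∀ a b c : ℕ, S a b c ≤ G a * G c + G (a + b) * G (b + c) + G (a + b + c) * G b) →
        (∀ a b c : ℕ, G a * G c + G (a + b + c) * G b - G (a + b) * G (b + c) ≤ S a b c) →
        (∀ N : ℕ, 1 ≤ N →
          S (2 * N) N (3 * N) * (G (2 * N + N) * G (N + 3 * N)) ≤
            G (2 * N) * G (3 * N) * (G (2 * N + N + 3 * N) * G N)) →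
        ∀ a b c : ℕ, 1 ≤ a → 1 ≤ b → 1 ≤ c →
          S a b c * (G (a + b) * G (b + c)) ≤ G a * G c * (G (a + b + c) * G b) := by
  intro h
  let G : ℕ → ℝ := fun n => if n < 3 then (1 / 3 : ℝ) ^ n else 1 / (3 * (n : ℝ) ^ 2)
  have hG : ∀ n : ℕ, G n = if n < 3 then (1 / 3 : ℝ) ^ n else 1 / (3 * (n : ℝ) ^ 2) := fun n => rfl
  let S : ℕ → ℕ → ℕ → ℝ := fun a b c =>
    G a * G c + G (a + b + c) * G b + G (a + b) * G (b + c) * (1 - 2 * (9 / 10 : ℝ))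
  have hS : ∀ a b c : ℕ,
      S a b c = G a * G c + G (a + b + c) * G b + G (a + b) * G (b + c) * (1 - 2 * (9 / 10 : ℝ)) :=
    fun a b c => rfl
  have hpos := model_pos hG
  have hsucc := model_succ_le hG
  have hlog := logConvex_global_of_local hpos (model_local hG)
  have hmms := mms_of_succ_le hpos hsucc
  have hsymm : ∀ a b c : ℕ, S a b c = S c b a := by
    intro a b c
    rw [hS, hS, show c + b + a = a + b + c by omega, show c + b = b + c by omega, show b + a = a + b by omega]
    ring
  have hgks : ∀ a b c : ℕ,
      G a * G c ≤ S a b c ∧ G (a + b) * G (b + c) ≤ S a b c ∧ G (a + b + c) * G b ≤ S a b c := by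
    intro a b c
    rw [hS]
    have h1 := hmms a b c
    have h2 := hlog a b c
    have h3 : 0 ≤ G (a + b) * G (b + c) := (mul_pos (hpos _) (hpos _)).le
    exact ⟨by linarith, by linarith, by linarith⟩
  have hleb : ∀ a b c : ℕ, S a b c ≤ G a * G c + G (a + b) * G (b + c) + G (a + b + c) * G b := by
    intro a b c
    rw [hS]
    have h3 : 0 ≤ G (a + b) * G (b + c) := (mul_pos (hpos _) (hpos _)).le
    linarith
  have hsw : ∀ a b c : ℕ, G a * G c + G (a + b + c) * G b - G (a + b) * G (b + c) ≤ S a b c := by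
    intro a b c
    rw [hS]
    have h3 : 0 ≤ G (a + b) * G (b + c) := (mul_pos (hpos _) (hpos _)).le
    linarith
  have hbal : ∀ N : ℕ, 1 ≤ N →
      S (2 * N) N (3 * N) * (G (2 * N + N) * G (N + 3 * N)) ≤
        G (2 * N) * G (3 * N) * (G (2 * N + N + 3 * N) * G N) := by
    intro N hN
    rw [hS]
    exact model_balanced hG (9 / 10) (by norm_num) N hN
  have h111 := h G S (model_zero hG) hpos (model_le_one hG) hsucc hmms hlog (model_bounds hG) hsymm hgks hleb
    hsw hbal 1 1 1 le_rfl le_rfl le_rfl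
  rw [hS] at h111
  exact model_not_spc_one_one_one hG (9 / 10) (by norm_num) h111

end Summit.CriticalPhenomena.Ising3DConformalLimit.InterlacingNegative
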